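import Mathlib.Analysis.Calculus.MeanValue
import Mathlib.Analysis.Calculus.LineDeriv.IntegrationByParts
import Literature.Analysis.FluidPDE.SingularKernelTruncation
import Literature.Analysis.FluidPDE.NewtonPotentialHolder
import Literature.Analysis.SingularIntegrals.TruncatedKernelL2Bound
import HarnessLib

/-!
# Smoothly truncated homogeneous kernels of degree `−3` on `ℝ³`: Calderón–Zygmund constants

Analysis/SingularIntegrals support file (everything proved, theorems only). For a real kernel `K` on `ℝ³` which is
`C¹` off the origin with `|K(z)| ≤ A|z|⁻³`, `‖∇K(z)‖ ≤ A|z|⁻⁴`, the smoothly truncated kernels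
`K_ε(z) = (1 − θ_ε(z)) K(z)` (`θ_ε = radialCutoff ε (2ε)` of `Literature.Analysis.FluidPDE`, `= 1` on `|z| ≤ ε`,
`= 0` on `|z| ≥ 2ε`) satisfy, **uniformly in `ε > 0`**, the three hypotheses (5.4.1)–(5.4.3) of Grafakos,
*Classical Fourier Analysis*, Thm. 5.4.1 in the form consumed by
`Literature.Analysis.SingularIntegrals.eLpNorm_truncatedKernel_convolution_le`:

* size `∫_{R ≤ |z| ≤ 2R} |K_ε| ≤ 8 A |B̄₁|` (`setIntegral_shell_abs_truncate_le`);
* Hörmander's condition `∫_{|z| ≥ 2|y|} |K_ε(z − y) − K_ε(z)| dz ≤ 24 A (1 + 2B) |B₁|` by the mean value inequality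
  along segments avoiding the ball `|·| < |z|/2` (`setIntegral_abs_truncate_sub_le`);
* the cancellation condition `|∫_{a<|z|<b} K_ε| ≤ |v| A' |B₁| (38C + 7B)` when `K = ∂_v G` off the origin with
  `|G| ≤ A'|z|⁻²` (`norm_setIntegral_shell_truncate_le`): integration by parts against smooth shell cutoffs, whose
  gradients live on shells of thickness `δ` where `|G| ≲ A' r⁻²`, then dominated convergence to sharp shells;
* the resulting **uniform `L²` bound** for the doubly truncated operators
  `f ↦ (1_{ε' < |·| < N} K_ε) ⋆ f` (`eLpNorm_truncate_convolution_le`, from `eLpNorm_truncatedKernel_convolution_le`).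

These are the frozen kernels of the second derivatives of the conic Bogovskiĭ operator (Mao–Oh–Tao, Lemma 2.3 (S3)).

## Mathlib / Literature search

Reused: `radialCutoff`, `exists_norm_fderiv_radialCutoff_le` (`SingularKernelTruncation`),
`NewtonPotentialHolder.integral_compl_ball_norm_rpow_neg` / `half_norm_le_of_mem_segment`,
`Convex.norm_image_sub_le_of_norm_fderiv_le`.
-/

noncomputable section

open MeasureTheory Set Function Filter Metric Real
open _root_.Topology
open scoped ENNReal NNReal
open Literature.Analysis.FluidPDE Literature.Analysis.FluidPDE.NewtonPotentialHolder

namespace Literature.Analysis.SingularIntegrals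

section Truncate

variable {K : (EuclideanSpace ℝ (Fin 3)) → ℝ} {A : ℝ} {ε : ℝ}

/-- `K_ε = 0` near any point of the open ball `|z| < ε`. [folklore] -/
theorem truncate_eventuallyEq_zero (K : (EuclideanSpace ℝ (Fin 3)) → ℝ) (hε : 0 < ε) {z : (EuclideanSpace ℝ (Fin 3))} (hz : ‖z‖ < ε) :
    (fun w : (EuclideanSpace ℝ (Fin 3)) ↦ (1 - radialCutoff ε (2 * ε) w) * K w) =ᶠ[𝓝 z] fun _ ↦ 0 := by
  filter_upwards [(radialCutoff_eventuallyEq_one (E := (EuclideanSpace ℝ (Fin 3))) (r₁ := 2 * ε) hε.le (by linarith) hz)] with w hw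
  rw [hw, sub_self, zero_mul]

/-- `K_ε = K` on `|z| ≥ 2ε`. [folklore] -/
theorem truncate_eq_self (K : (EuclideanSpace ℝ (Fin 3)) → ℝ) (hε : 0 < ε) {z : (EuclideanSpace ℝ (Fin 3))} (hz : 2 * ε ≤ ‖z‖) :
    (1 - radialCutoff ε (2 * ε) z) * K z = K z := by
  rw [radialCutoff_eq_zero hε.le (by linarith) hz, sub_zero, one_mul]

/-- `K_ε = 0` on `|z| ≤ ε`. [folklore] -/
theorem truncate_eq_zero (K : (EuclideanSpace ℝ (Fin 3)) → ℝ) (hε : 0 < ε) {z : (EuclideanSpace ℝ (Fin 3))} (hz : ‖z‖ ≤ ε) :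
    (1 - radialCutoff ε (2 * ε) z) * K z = 0 := by
  rw [radialCutoff_eq_one hε.le (by linarith) hz, sub_self, zero_mul]

/-- `|1 − θ_ε| ≤ 1`. [folklore] -/
theorem abs_one_sub_radialCutoff_le (ε : ℝ) (z : (EuclideanSpace ℝ (Fin 3))) : |1 - radialCutoff ε (2 * ε) z| ≤ 1 := by
  rw [abs_le]
  constructor <;> linarith [radialCutoff_nonneg ε (2 * ε) z, radialCutoff_le_one ε (2 * ε) z]

/-- **The truncated kernel is `C¹`** when `K` is `C¹` off the origin. [folklore] -/
theorem contDiff_truncate (hK : ContDiffOn ℝ 1 K {0}ᶜ) (hε : 0 < ε) :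
    ContDiff ℝ 1 fun z : (EuclideanSpace ℝ (Fin 3)) ↦ (1 - radialCutoff ε (2 * ε) z) * K z := by
  rw [contDiff_iff_contDiffAt]
  intro z
  by_cases hz : ‖z‖ < ε
  · exact (contDiffAt_const (c := (0 : ℝ))).congr_of_eventuallyEq (truncate_eventuallyEq_zero K hε hz)
  · have hz0 : z ≠ 0 := by
      intro h
      rw [h, norm_zero] at hz
      exact hz hε
    have hθc : ContDiff ℝ 1 (radialCutoff ε (2 * ε) : (EuclideanSpace ℝ (Fin 3)) → ℝ) := radialCutoff_contDiff ε (2 * ε)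
    exact (contDiff_const.sub hθc).contDiffAt.mul (hK.contDiffAt (isOpen_compl_singleton.mem_nhds hz0))

/-- **Size of the truncated kernel**: `|K_ε(z)| ≤ A|z|⁻³` (for all `z`, the origin included). [folklore] -/
theorem abs_truncate_le (hA0 : ∀ z : (EuclideanSpace ℝ (Fin 3)), z ≠ 0 → |K z| ≤ A * (‖z‖ ^ 3)⁻¹) (hε : 0 < ε) (z : (EuclideanSpace ℝ (Fin 3))) :
    |(1 - radialCutoff ε (2 * ε) z) * K z| ≤ A * (‖z‖ ^ 3)⁻¹ := by
  by_cases hz : z = 0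
  · subst hz
    rw [truncate_eq_zero K hε (by simp [hε.le])]
    simp
  rw [abs_mul]
  calc |1 - radialCutoff ε (2 * ε) z| * |K z| ≤ 1 * (A * (‖z‖ ^ 3)⁻¹) :=
        mul_le_mul (abs_one_sub_radialCutoff_le ε z) (hA0 z hz) (abs_nonneg _) zero_le_one
    _ = _ := one_mul _

end Truncate

section Gradient

variable {K : (EuclideanSpace ℝ (Fin 3)) → ℝ} {A : ℝ} {ε : ℝ}

/-- The derivative of the truncated kernel off the origin (product rule):
`∇K_ε(z) e = −(∇θ_ε(z) e) K(z) + (1 − θ_ε(z)) ∇K(z) e`. [folklore] -/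
theorem fderiv_truncate_apply (hK : ContDiffOn ℝ 1 K {0}ᶜ) {z : (EuclideanSpace ℝ (Fin 3))} (hz : z ≠ 0) (e : (EuclideanSpace ℝ (Fin 3))) :
    fderiv ℝ (fun w : (EuclideanSpace ℝ (Fin 3)) ↦ (1 - radialCutoff ε (2 * ε) w) * K w) z e =
      -(fderiv ℝ (radialCutoff ε (2 * ε)) z e) * K z + (1 - radialCutoff ε (2 * ε) z) * fderiv ℝ K z e := by
  have hθ : DifferentiableAt ℝ (fun w : (EuclideanSpace ℝ (Fin 3)) ↦ 1 - radialCutoff ε (2 * ε) w) z :=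
    ((radialCutoff_contDiff (E' := (EuclideanSpace ℝ (Fin 3))) ε (2 * ε) (n := 1)).differentiable one_ne_zero z).const_sub 1
  have hKd : DifferentiableAt ℝ K z :=
    (hK.contDiffAt (isOpen_compl_singleton.mem_nhds hz)).differentiableAt one_ne_zero
  rw [fderiv_fun_mul hθ hKd, fderiv_const_sub]
  simp only [_root_.add_apply, _root_.smul_apply, smul_eq_mul, _root_.neg_apply]
  ring

/-- **Size of the gradient of the truncated kernel**: with the cutoff constant `B` of
`exists_norm_fderiv_radialCutoff_le`, `‖∇K_ε(z)‖ ≤ A(1 + 2B)|z|⁻⁴` for `z ≠ 0`. [folklore] -/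
theorem norm_fderiv_truncate_le (hK : ContDiffOn ℝ 1 K {0}ᶜ) (hA0 : ∀ z : (EuclideanSpace ℝ (Fin 3)), z ≠ 0 → |K z| ≤ A * (‖z‖ ^ 3)⁻¹)
    (hA1 : ∀ z : (EuclideanSpace ℝ (Fin 3)), z ≠ 0 → ‖fderiv ℝ K z‖ ≤ A * (‖z‖ ^ 4)⁻¹) {B : ℝ} (hB0 : 0 ≤ B)
    (hB : ∀ ε : ℝ, 0 < ε → ∀ z : (EuclideanSpace ℝ (Fin 3)), ‖fderiv ℝ (radialCutoff ε (2 * ε)) z‖ ≤ B * ε⁻¹) (hε : 0 < ε) {z : (EuclideanSpace ℝ (Fin 3))}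
    (hz : z ≠ 0) :
    ‖fderiv ℝ (fun w : (EuclideanSpace ℝ (Fin 3)) ↦ (1 - radialCutoff ε (2 * ε) w) * K w) z‖ ≤ A * (1 + 2 * B) * (‖z‖ ^ 4)⁻¹ := by
  have hzn : 0 < ‖z‖ := norm_pos_iff.2 hz
  have hA : 0 ≤ A := by
    have h := hA0 z hz
    by_contra hA'
    have : A * (‖z‖ ^ 3)⁻¹ < 0 := mul_neg_of_neg_of_pos (not_le.1 hA') (by positivity)
    linarith [abs_nonneg (K z)]
  by_cases hsmall : ‖z‖ < ε
  · have : fderiv ℝ (fun w : (EuclideanSpace ℝ (Fin 3)) ↦ (1 - radialCutoff ε (2 * ε) w) * K w) z = 0 := by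
      rw [(truncate_eventuallyEq_zero K hε hsmall).fderiv_eq]
      exact fderiv_const_apply 0
    rw [this, norm_zero]
    positivity
  · have hεz : ε ≤ ‖z‖ := not_lt.1 hsmall
    refine ContinuousLinearMap.opNorm_le_bound _ (by positivity) fun e ↦ ?_
    rw [fderiv_truncate_apply hK hz e, Real.norm_eq_abs]
    have hcut : |-(fderiv ℝ (radialCutoff ε (2 * ε)) z e) * K z| ≤ 2 * A * B * (‖z‖ ^ 4)⁻¹ * ‖e‖ := by
      by_cases hbig : 2 * ε < ‖z‖
      · have h0 : fderiv ℝ (radialCutoff ε (2 * ε)) z = 0 := by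
          rw [(radialCutoff_eventuallyEq_zero (E := (EuclideanSpace ℝ (Fin 3))) hε.le (by linarith) hbig).fderiv_eq]
          exact fderiv_const_apply (0 : ℝ)
        rw [h0, _root_.zero_apply, neg_zero, zero_mul, abs_zero]
        positivity
      · have hz2 : ‖z‖ ≤ 2 * ε := not_lt.1 hbig
        rw [abs_mul, abs_neg]
        have h1 : |fderiv ℝ (radialCutoff ε (2 * ε)) z e| ≤ B * ε⁻¹ * ‖e‖ := by
          rw [← Real.norm_eq_abs]
          exact (ContinuousLinearMap.le_opNorm _ e).trans (by gcongr; exact hB ε hε z)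
        have hεinv : ε⁻¹ ≤ 2 * ‖z‖⁻¹ := by
          rw [← div_eq_mul_inv, le_div_iff₀ hzn, inv_mul_le_iff₀ hε]
          linarith
        calc |fderiv ℝ (radialCutoff ε (2 * ε)) z e| * |K z| ≤ (B * ε⁻¹ * ‖e‖) * (A * (‖z‖ ^ 3)⁻¹) := by
              gcongr; exact hA0 z hz
          _ ≤ (B * (2 * ‖z‖⁻¹) * ‖e‖) * (A * (‖z‖ ^ 3)⁻¹) := by gcongr
          _ = 2 * A * B * (‖z‖ ^ 4)⁻¹ * ‖e‖ := by field_simp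
    have hker : |(1 - radialCutoff ε (2 * ε) z) * fderiv ℝ K z e| ≤ A * (‖z‖ ^ 4)⁻¹ * ‖e‖ := by
      rw [abs_mul]
      have h2 : |fderiv ℝ K z e| ≤ A * (‖z‖ ^ 4)⁻¹ * ‖e‖ := by
        rw [← Real.norm_eq_abs]
        exact (ContinuousLinearMap.le_opNorm _ e).trans (by gcongr; exact hA1 z hz)
      calc |1 - radialCutoff ε (2 * ε) z| * |fderiv ℝ K z e| ≤ 1 * (A * (‖z‖ ^ 4)⁻¹ * ‖e‖) :=
            mul_le_mul (abs_one_sub_radialCutoff_le ε z) h2 (abs_nonneg _) zero_le_one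
        _ = _ := one_mul _
    calc _ ≤ |-(fderiv ℝ (radialCutoff ε (2 * ε)) z e) * K z| + |(1 - radialCutoff ε (2 * ε) z) * fderiv ℝ K z e| :=
          abs_add_le _ _
      _ ≤ 2 * A * B * (‖z‖ ^ 4)⁻¹ * ‖e‖ + A * (‖z‖ ^ 4)⁻¹ * ‖e‖ := add_le_add hcut hker
      _ = A * (1 + 2 * B) * (‖z‖ ^ 4)⁻¹ * ‖e‖ := by ring

/-- Nonnegativity of the size constant (if the size bound holds at one point). [folklore] -/
theorem nonneg_of_abs_le_mul_inv (hA0 : ∀ z : (EuclideanSpace ℝ (Fin 3)), z ≠ 0 → |K z| ≤ A * (‖z‖ ^ 3)⁻¹) : 0 ≤ A := by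
  obtain ⟨z, hz⟩ := exists_ne (0 : (EuclideanSpace ℝ (Fin 3)))
  have h := hA0 z hz
  by_contra hA'
  have hzn : 0 < ‖z‖ := norm_pos_iff.2 hz
  have : A * (‖z‖ ^ 3)⁻¹ < 0 := mul_neg_of_neg_of_pos (not_le.1 hA') (by positivity)
  linarith [abs_nonneg (K z)]

/-- **Hörmander's condition, pointwise**: for `|z| ≥ 2|y|`,
`|K_ε(z − y) − K_ε(z)| ≤ 16 A (1 + 2B) |y| |z|⁻⁴` (mean value inequality on the segment `[z − y, z]`, which stays
in `|·| ≥ |z|/2`). [folklore] -/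
theorem abs_truncate_sub_le (hK : ContDiffOn ℝ 1 K {0}ᶜ) (hA0 : ∀ z : (EuclideanSpace ℝ (Fin 3)), z ≠ 0 → |K z| ≤ A * (‖z‖ ^ 3)⁻¹)
    (hA1 : ∀ z : (EuclideanSpace ℝ (Fin 3)), z ≠ 0 → ‖fderiv ℝ K z‖ ≤ A * (‖z‖ ^ 4)⁻¹) {B : ℝ} (hB0 : 0 ≤ B)
    (hB : ∀ ε : ℝ, 0 < ε → ∀ z : (EuclideanSpace ℝ (Fin 3)), ‖fderiv ℝ (radialCutoff ε (2 * ε)) z‖ ≤ B * ε⁻¹) (hε : 0 < ε) {y z : (EuclideanSpace ℝ (Fin 3))}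
    (hy : y ≠ 0) (hyz : 2 * ‖y‖ ≤ ‖z‖) :
    |(1 - radialCutoff ε (2 * ε) (z - y)) * K (z - y) - (1 - radialCutoff ε (2 * ε) z) * K z| ≤
      16 * A * (1 + 2 * B) * ‖y‖ * (‖z‖ ^ 4)⁻¹ := by
  have hA : 0 ≤ A := nonneg_of_abs_le_mul_inv hA0
  have hyn : 0 < ‖y‖ := norm_pos_iff.2 hy
  have hzn : 0 < ‖z‖ := by linarith
  set κ : (EuclideanSpace ℝ (Fin 3)) → ℝ := fun w ↦ (1 - radialCutoff ε (2 * ε) w) * K w with hκ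
  have hdiff : Differentiable ℝ κ := (contDiff_truncate hK hε).differentiable one_ne_zero
  -- on the segment `[z - y, z]` one has `|w| ≥ |z|/2`
  have hseg : ∀ w ∈ segment ℝ (z - y) z, ‖z‖ / 2 ≤ ‖w‖ := by
    intro w hw
    -- `half_norm_le_of_mem_segment` with `x := z`, `z := z + y` hmm: use it with points `x - y' = z - y`, ...
    have h := half_norm_le_of_mem_segment (x := z) (z := z - y) (y := 0) (w := w) ?_ ?_
    · simpa using h
    · simp only [sub_sub_cancel, sub_zero]; linarith
    · rw [segment_symm]; simpa using hw
  have hbound : ∀ w ∈ segment ℝ (z - y) z, ‖fderiv ℝ κ w‖ ≤ 16 * A * (1 + 2 * B) * (‖z‖ ^ 4)⁻¹ := by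
    intro w hw
    have hw2 := hseg w hw
    have hwn : 0 < ‖w‖ := by linarith
    have hw0 : w ≠ 0 := norm_pos_iff.1 hwn
    calc ‖fderiv ℝ κ w‖ ≤ A * (1 + 2 * B) * (‖w‖ ^ 4)⁻¹ := norm_fderiv_truncate_le hK hA0 hA1 hB0 hB hε hw0
      _ ≤ A * (1 + 2 * B) * ((‖z‖ / 2) ^ 4)⁻¹ := by
          gcongr
      _ = 16 * A * (1 + 2 * B) * (‖z‖ ^ 4)⁻¹ := by field_simp; ring
  have hmvt := (convex_segment (z - y) z).norm_image_sub_le_of_norm_fderiv_le (𝕜 := ℝ) (f := κ)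
    (fun w _ ↦ hdiff w) hbound (left_mem_segment ℝ (z - y) z) (right_mem_segment ℝ (z - y) z)
  rw [show z - (z - y) = y by abel] at hmvt
  rw [← Real.norm_eq_abs, ← norm_neg, neg_sub]
  calc ‖κ z - κ (z - y)‖ ≤ 16 * A * (1 + 2 * B) * (‖z‖ ^ 4)⁻¹ * ‖y‖ := hmvt
    _ = _ := by ring

end Gradient

section Integrals

variable {K : (EuclideanSpace ℝ (Fin 3)) → ℝ} {A : ℝ} {ε : ℝ}

/-- The truncated kernel is integrable on bounded shells (it is continuous). [folklore] -/
theorem integrableOn_truncate (hK : ContDiffOn ℝ 1 K {0}ᶜ) (hε : 0 < ε) (a b : ℝ) :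
    IntegrableOn (fun z : (EuclideanSpace ℝ (Fin 3)) ↦ (1 - radialCutoff ε (2 * ε) z) * K z) (closedBall (0 : (EuclideanSpace ℝ (Fin 3))) b \ ball 0 a) :=
  ((contDiff_truncate hK hε).continuous.continuousOn.integrableOn_compact (isCompact_closedBall _ _)).mono_set
    fun _ hz ↦ hz.1

/-- Volume of a closed ball in `ℝ³`: `|B̄_r| = r³ |B₁|`. [folklore] -/
theorem volume_real_closedBall_eq (r : ℝ) (hr : 0 ≤ r) :
    (volume : Measure (EuclideanSpace ℝ (Fin 3))).real (closedBall 0 r) = r ^ 3 * (volume : Measure (EuclideanSpace ℝ (Fin 3))).real (ball 0 1) := by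
  rw [measureReal_def, measureReal_def, Measure.addHaar_closedBall _ _ hr, ENNReal.toReal_mul,
    ENNReal.toReal_ofReal (by positivity), finrank_euclideanSpace_fin]

/-- **Size condition (5.4.1)** for the truncated kernel: `∫_{R ≤ |z| ≤ 2R} |K_ε| ≤ 8 A |B₁|`. [folklore] -/
theorem setIntegral_shell_norm_truncate_le (hA0 : ∀ z : (EuclideanSpace ℝ (Fin 3)), z ≠ 0 → |K z| ≤ A * (‖z‖ ^ 3)⁻¹) (hε : 0 < ε)
    {R : ℝ} (hR : 0 < R) :
    ∫ z in closedBall (0 : (EuclideanSpace ℝ (Fin 3))) (2 * R) \ ball 0 R, ‖(1 - radialCutoff ε (2 * ε) z) * K z‖ ≤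
      8 * A * (volume : Measure (EuclideanSpace ℝ (Fin 3))).real (ball 0 1) := by
  have hA : 0 ≤ A := nonneg_of_abs_le_mul_inv hA0
  have hfin : volume (closedBall (0 : (EuclideanSpace ℝ (Fin 3))) (2 * R) \ ball 0 R) < ⊤ :=
    (measure_mono fun _ hz ↦ hz.1).trans_lt measure_closedBall_lt_top
  have hpt : ∀ z ∈ closedBall (0 : (EuclideanSpace ℝ (Fin 3))) (2 * R) \ ball 0 R, ‖‖(1 - radialCutoff ε (2 * ε) z) * K z‖‖ ≤ A * (R ^ 3)⁻¹ := by
    intro z hz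
    rw [norm_norm, Real.norm_eq_abs]
    have hRz : R ≤ ‖z‖ := by simpa using hz.2
    calc _ ≤ A * (‖z‖ ^ 3)⁻¹ := abs_truncate_le hA0 hε z
      _ ≤ A * (R ^ 3)⁻¹ := by gcongr
  have h := norm_setIntegral_le_of_norm_le_const hfin hpt
  rw [Real.norm_of_nonneg (integral_nonneg fun _ ↦ norm_nonneg _)] at h
  refine h.trans ?_
  have hvol : (volume : Measure (EuclideanSpace ℝ (Fin 3))).real (closedBall (0 : (EuclideanSpace ℝ (Fin 3))) (2 * R) \ ball 0 R) ≤
      (2 * R) ^ 3 * (volume : Measure (EuclideanSpace ℝ (Fin 3))).real (ball 0 1) := by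
    rw [← volume_real_closedBall_eq (2 * R) (by positivity)]
    exact measureReal_mono (fun _ hz ↦ hz.1) (measure_closedBall_lt_top.ne)
  calc A * (R ^ 3)⁻¹ * (volume : Measure (EuclideanSpace ℝ (Fin 3))).real (closedBall (0 : (EuclideanSpace ℝ (Fin 3))) (2 * R) \ ball 0 R)
      ≤ A * (R ^ 3)⁻¹ * ((2 * R) ^ 3 * (volume : Measure (EuclideanSpace ℝ (Fin 3))).real (ball 0 1)) := by gcongr
    _ = 8 * A * (volume : Measure (EuclideanSpace ℝ (Fin 3))).real (ball 0 1) := by field_simp; ring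

/-- **Hörmander's condition (5.4.2)** for the truncated kernel:
`∫_{2|y| ≤ |z| ≤ N} |K_ε(z − y) − K_ε(z)| dz ≤ 24 A (1 + 2B) |B₁|`. [folklore] -/
theorem setIntegral_norm_truncate_sub_le (hK : ContDiffOn ℝ 1 K {0}ᶜ)
    (hA0 : ∀ z : (EuclideanSpace ℝ (Fin 3)), z ≠ 0 → |K z| ≤ A * (‖z‖ ^ 3)⁻¹) (hA1 : ∀ z : (EuclideanSpace ℝ (Fin 3)), z ≠ 0 → ‖fderiv ℝ K z‖ ≤ A * (‖z‖ ^ 4)⁻¹)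
    {B : ℝ} (hB0 : 0 ≤ B) (hB : ∀ ε : ℝ, 0 < ε → ∀ z : (EuclideanSpace ℝ (Fin 3)), ‖fderiv ℝ (radialCutoff ε (2 * ε)) z‖ ≤ B * ε⁻¹)
    (hε : 0 < ε) {y : (EuclideanSpace ℝ (Fin 3))} (hy : y ≠ 0) (N : ℝ) :
    ∫ z in closedBall (0 : (EuclideanSpace ℝ (Fin 3))) N \ ball 0 (2 * ‖y‖),
        ‖(1 - radialCutoff ε (2 * ε) (z - y)) * K (z - y) - (1 - radialCutoff ε (2 * ε) z) * K z‖ ≤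
      24 * A * (1 + 2 * B) * (volume : Measure (EuclideanSpace ℝ (Fin 3))).real (ball 0 1) := by
  have hA : 0 ≤ A := nonneg_of_abs_le_mul_inv hA0
  have hyn : 0 < ‖y‖ := norm_pos_iff.2 hy
  set κ : (EuclideanSpace ℝ (Fin 3)) → ℝ := fun w ↦ (1 - radialCutoff ε (2 * ε) w) * K w with hκ
  have hcont : Continuous κ := (contDiff_truncate hK hε).continuous
  set S := closedBall (0 : (EuclideanSpace ℝ (Fin 3))) N \ ball 0 (2 * ‖y‖) with hS
  have hSm : MeasurableSet S := measurableSet_closedBall.diff measurableSet_ball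
  -- Step 1: pointwise bound on `S` and passage to the radial majorant on `(ball 0 (2|y|))ᶜ`
  have hmaj_int : IntegrableOn (fun z : (EuclideanSpace ℝ (Fin 3)) ↦ 16 * A * (1 + 2 * B) * ‖y‖ * ‖z‖ ^ (-(4 : ℝ)))
      (ball (0 : (EuclideanSpace ℝ (Fin 3))) (2 * ‖y‖))ᶜ :=
    (integrableOn_compl_ball_norm_rpow_neg (by norm_num) (by positivity)).const_mul _
  have h1 : ∫ z in S, ‖κ (z - y) - κ z‖ ≤ ∫ z in S, 16 * A * (1 + 2 * B) * ‖y‖ * ‖z‖ ^ (-(4 : ℝ)) := by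
    have hL : IntegrableOn (fun z ↦ ‖κ (z - y) - κ z‖) S :=
      (((hcont.comp (continuous_id.sub continuous_const)).sub hcont).norm.continuousOn.integrableOn_compact
        (isCompact_closedBall 0 N)).mono_set fun _ hz ↦ hz.1
    refine setIntegral_mono_on hL (hmaj_int.mono_set fun _ hz ↦ hz.2) hSm fun z hz ↦ ?_
    have hz2 : 2 * ‖y‖ ≤ ‖z‖ := by simpa using hz.2
    have hzn : 0 < ‖z‖ := by linarith
    rw [Real.norm_eq_abs, Real.rpow_neg hzn.le, show (4 : ℝ) = ((4 : ℕ) : ℝ) by norm_num, Real.rpow_natCast]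
    exact abs_truncate_sub_le hK hA0 hA1 hB0 hB hε hy hz2
  -- Step 2: enlarge the domain and evaluate the radial integral
  have h2 : ∫ z in S, 16 * A * (1 + 2 * B) * ‖y‖ * ‖z‖ ^ (-(4 : ℝ)) ≤
      ∫ z in (ball (0 : (EuclideanSpace ℝ (Fin 3))) (2 * ‖y‖))ᶜ, 16 * A * (1 + 2 * B) * ‖y‖ * ‖z‖ ^ (-(4 : ℝ)) :=
    setIntegral_mono_set hmaj_int (Eventually.of_forall fun z ↦ by positivity)
      (Eventually.of_forall fun (z : (EuclideanSpace ℝ (Fin 3))) (hz : z ∈ S) ↦ show z ∈ (ball (0 : (EuclideanSpace ℝ (Fin 3))) (2 * ‖y‖))ᶜ from hz.2)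
  have h3 : ∫ z in (ball (0 : (EuclideanSpace ℝ (Fin 3))) (2 * ‖y‖))ᶜ, 16 * A * (1 + 2 * B) * ‖y‖ * ‖z‖ ^ (-(4 : ℝ)) =
      24 * A * (1 + 2 * B) * (volume : Measure (EuclideanSpace ℝ (Fin 3))).real (ball 0 1) := by
    rw [integral_const_mul, integral_compl_ball_norm_rpow_neg (by norm_num) (by positivity)]
    rw [show (3 : ℝ) - 4 = -1 by norm_num, Real.rpow_neg_one]
    field_simp
    ring
  exact h1.trans (h2.trans h3.le)

end Integrals


section CutoffGradient

/-- **A universal bound for the derivative of the smooth transition**: `|smoothTransition'| ≤ C`. [folklore] -/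
theorem exists_norm_deriv_smoothTransition_le : ∃ C : ℝ, 0 ≤ C ∧ ∀ x : ℝ, ‖deriv Real.smoothTransition x‖ ≤ C := by
  have hc : Continuous (deriv Real.smoothTransition) :=
    (Real.smoothTransition.contDiff (n := 1)).continuous_deriv le_rfl
  have hsupp : HasCompactSupport (deriv Real.smoothTransition) := by
    refine HasCompactSupport.intro isCompact_Icc (K := Icc (0 : ℝ) 1) fun x hx ↦ ?_
    rw [mem_Icc, not_and_or, not_le, not_le] at hx
    rcases hx with hx | hx
    · have h : Real.smoothTransition =ᶠ[𝓝 x] fun _ ↦ (0 : ℝ) := by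
        filter_upwards [Iio_mem_nhds hx] with y hy
        exact Real.smoothTransition.zero_of_nonpos (le_of_lt hy)
      rw [h.deriv_eq]; exact deriv_const x 0
    · have h : Real.smoothTransition =ᶠ[𝓝 x] fun _ ↦ (1 : ℝ) := by
        filter_upwards [Ioi_mem_nhds hx] with y hy
        exact Real.smoothTransition.one_of_one_le (le_of_lt hy)
      rw [h.deriv_eq]; exact deriv_const x 1
  obtain ⟨C, hC⟩ := hc.bounded_above_of_compact_support hsupp
  exact ⟨max C 0, le_max_right _ _, fun x ↦ (hC x).trans (le_max_left _ _)⟩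

/-- The derivative of the radial cutoff `θ_{r₀,r₁}(z) = ST((r₁² − |z|²)/(r₁² − r₀²))` (chain rule). [folklore] -/
theorem hasFDerivAt_radialCutoff (r₀ r₁ : ℝ) (z : (EuclideanSpace ℝ (Fin 3))) :
    HasFDerivAt (radialCutoff r₀ r₁ : (EuclideanSpace ℝ (Fin 3)) → ℝ)
      ((deriv Real.smoothTransition ((r₁ ^ 2 - ‖z‖ ^ 2) / (r₁ ^ 2 - r₀ ^ 2)) * (-(r₁ ^ 2 - r₀ ^ 2)⁻¹)) •
        ((2 : ℝ) • innerSL ℝ z)) z := by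
  have h1 : HasFDerivAt (fun z : (EuclideanSpace ℝ (Fin 3)) ↦ ‖z‖ ^ 2) ((2 : ℝ) • innerSL ℝ z) z :=
    (hasStrictFDerivAt_norm_sq z).hasFDerivAt.congr_fderiv ((two_nsmul _).trans (two_smul ℝ _).symm)
  have h2 : HasDerivAt (fun σ : ℝ ↦ (r₁ ^ 2 - σ) / (r₁ ^ 2 - r₀ ^ 2)) (-(r₁ ^ 2 - r₀ ^ 2)⁻¹) (‖z‖ ^ 2) := by
    have := ((hasDerivAt_id (‖z‖ ^ 2)).const_sub (r₁ ^ 2)).div_const (r₁ ^ 2 - r₀ ^ 2)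
    exact this.congr_deriv (by rw [neg_div, one_div])
  have h3 : HasDerivAt Real.smoothTransition (deriv Real.smoothTransition ((r₁ ^ 2 - ‖z‖ ^ 2) / (r₁ ^ 2 - r₀ ^ 2)))
      ((r₁ ^ 2 - ‖z‖ ^ 2) / (r₁ ^ 2 - r₀ ^ 2)) :=
    (Real.smoothTransition.contDiffAt.differentiableAt (by norm_num : (1 : WithTop ℕ∞) ≠ 0)).hasDerivAt
  have h4 := (h3.comp (‖z‖ ^ 2) h2).comp_hasFDerivAt z h1
  exact h4

/-- **Gradient bound for the radial cutoff at a general pair of radii**: with the constant `C` of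
`exists_norm_deriv_smoothTransition_le`, `‖∇θ_{r₀,r₁}(z)‖ ≤ 2C/(r₁ − r₀)` for `0 ≤ r₀ < r₁`. [folklore] -/
theorem norm_fderiv_radialCutoff_le {C : ℝ} (hC0 : 0 ≤ C) (hC : ∀ x : ℝ, ‖deriv Real.smoothTransition x‖ ≤ C)
    {r₀ r₁ : ℝ} (h₀ : 0 ≤ r₀) (h₁ : r₀ < r₁) (z : (EuclideanSpace ℝ (Fin 3))) :
    ‖fderiv ℝ (radialCutoff r₀ r₁ : (EuclideanSpace ℝ (Fin 3)) → ℝ) z‖ ≤ 2 * C / (r₁ - r₀) := by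
  have hr₁ : 0 < r₁ := lt_of_le_of_lt h₀ h₁
  have hd : 0 < r₁ ^ 2 - r₀ ^ 2 := by nlinarith
  by_cases hz : r₁ < ‖z‖
  · rw [(radialCutoff_eventuallyEq_zero (E := (EuclideanSpace ℝ (Fin 3))) h₀ h₁ hz).fderiv_eq, fderiv_const_apply, norm_zero]
    positivity
  · have hz' : ‖z‖ ≤ r₁ := not_lt.1 hz
    rw [(hasFDerivAt_radialCutoff r₀ r₁ z).fderiv, norm_smul, norm_smul, Real.norm_eq_abs, Real.norm_eq_abs,
      abs_mul, abs_neg, abs_inv, abs_of_pos hd, abs_two, innerSL_apply_norm]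
    calc |deriv Real.smoothTransition ((r₁ ^ 2 - ‖z‖ ^ 2) / (r₁ ^ 2 - r₀ ^ 2))| * (r₁ ^ 2 - r₀ ^ 2)⁻¹ * (2 * ‖z‖)
        ≤ C * (r₁ ^ 2 - r₀ ^ 2)⁻¹ * (2 * r₁) := by
          gcongr
          exact (Real.norm_eq_abs _).symm.le.trans (hC _)
      _ ≤ 2 * C / (r₁ - r₀) := by
          rw [div_eq_mul_inv, show r₁ ^ 2 - r₀ ^ 2 = (r₁ - r₀) * (r₁ + r₀) by ring, mul_inv]
          have hsub : 0 < r₁ - r₀ := by linarith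
          have hkey : (r₁ + r₀)⁻¹ * r₁ ≤ 1 := by
            rw [inv_mul_le_iff₀ (by linarith)]; linarith
          calc C * ((r₁ - r₀)⁻¹ * (r₁ + r₀)⁻¹) * (2 * r₁) = 2 * C * (r₁ - r₀)⁻¹ * ((r₁ + r₀)⁻¹ * r₁) := by ring
            _ ≤ 2 * C * (r₁ - r₀)⁻¹ * 1 := by gcongr
            _ = _ := mul_one _

/-- The gradient of `θ_{r₀,r₁}` vanishes inside the inner ball. [folklore] -/
theorem fderiv_radialCutoff_eq_zero_of_lt {r₀ r₁ : ℝ} (h₀ : 0 ≤ r₀) (h₁ : r₀ < r₁) {z : (EuclideanSpace ℝ (Fin 3))} (hz : ‖z‖ < r₀) :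
    fderiv ℝ (radialCutoff r₀ r₁ : (EuclideanSpace ℝ (Fin 3)) → ℝ) z = 0 := by
  rw [(radialCutoff_eventuallyEq_one (E := (EuclideanSpace ℝ (Fin 3))) h₀ h₁ hz).fderiv_eq, fderiv_const_apply]

/-- The gradient of `θ_{r₀,r₁}` vanishes outside the outer ball. [folklore] -/
theorem fderiv_radialCutoff_eq_zero_of_gt {r₀ r₁ : ℝ} (h₀ : 0 ≤ r₀) (h₁ : r₀ < r₁) {z : (EuclideanSpace ℝ (Fin 3))} (hz : r₁ < ‖z‖) :
    fderiv ℝ (radialCutoff r₀ r₁ : (EuclideanSpace ℝ (Fin 3)) → ℝ) z = 0 := by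
  rw [(radialCutoff_eventuallyEq_zero (E := (EuclideanSpace ℝ (Fin 3))) h₀ h₁ hz).fderiv_eq, fderiv_const_apply]

end CutoffGradient

section ShellVolume

/-- Volume of a spherical shell in `ℝ³`: `|{r₀ ≤ |z| ≤ r₁}| = (r₁³ − r₀³)|B₁|` (`0 ≤ r₀ ≤ r₁`). [folklore] -/
theorem volume_real_closedBall_diff_ball {r₀ r₁ : ℝ} (h₀ : 0 ≤ r₀) (h₁ : r₀ ≤ r₁) :
    (volume : Measure (EuclideanSpace ℝ (Fin 3))).real (closedBall 0 r₁ \ ball 0 r₀) = (r₁ ^ 3 - r₀ ^ 3) * (volume : Measure (EuclideanSpace ℝ (Fin 3))).real (ball 0 1) := by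
  have hsub : ball (0 : (EuclideanSpace ℝ (Fin 3))) r₀ ⊆ closedBall 0 r₁ := ball_subset_closedBall.trans (closedBall_subset_closedBall h₁)
  rw [measureReal_sdiff hsub measurableSet_ball measure_closedBall_lt_top.ne, measureReal_def, measureReal_def,
    Measure.addHaar_closedBall _ _ (h₀.trans h₁), Measure.addHaar_ball _ _ h₀, ENNReal.toReal_mul,
    ENNReal.toReal_mul, finrank_euclideanSpace_fin, ENNReal.toReal_ofReal (pow_nonneg (h₀.trans h₁) _),
    ENNReal.toReal_ofReal (pow_nonneg h₀ _), measureReal_def]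
  ring

/-- **Shell integral of `|z|⁻²`**: `∫_{r₀ ≤ |z| ≤ r₁} M |z|⁻² ≤ M r₀⁻² (r₁³ − r₀³)|B₁|` for `0 < r₀ ≤ r₁`, `0 ≤ M`.
[folklore] -/
theorem setIntegral_shell_inv_sq_le {r₀ r₁ M : ℝ} (h₀ : 0 < r₀) (h₁ : r₀ ≤ r₁) (hM : 0 ≤ M) {f : (EuclideanSpace ℝ (Fin 3)) → ℝ}
    (hf : ∀ z, r₀ ≤ ‖z‖ → ‖f z‖ ≤ M * (‖z‖ ^ 2)⁻¹) :
    ‖∫ z in closedBall (0 : (EuclideanSpace ℝ (Fin 3))) r₁ \ ball 0 r₀, f z‖ ≤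
      M * (r₀ ^ 2)⁻¹ * ((r₁ ^ 3 - r₀ ^ 3) * (volume : Measure (EuclideanSpace ℝ (Fin 3))).real (ball 0 1)) := by
  have hfin : volume (closedBall (0 : (EuclideanSpace ℝ (Fin 3))) r₁ \ ball 0 r₀) < ⊤ :=
    (measure_mono fun _ hz ↦ hz.1).trans_lt measure_closedBall_lt_top
  have hpt : ∀ z ∈ closedBall (0 : (EuclideanSpace ℝ (Fin 3))) r₁ \ ball 0 r₀, ‖f z‖ ≤ M * (r₀ ^ 2)⁻¹ := by
    intro z hz
    have hr : r₀ ≤ ‖z‖ := by simpa using hz.2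
    calc ‖f z‖ ≤ M * (‖z‖ ^ 2)⁻¹ := hf z hr
      _ ≤ M * (r₀ ^ 2)⁻¹ := by gcongr
  have h := norm_setIntegral_le_of_norm_le_const hfin hpt
  rwa [volume_real_closedBall_diff_ball h₀.le h₁] at h

end ShellVolume

section ShellCutoff

/-- A continuous function vanishing on a ball around the origin times a function continuous off the origin is
continuous. [folklore] -/
theorem continuous_mul_of_eqOn_ball_zero {u G : (EuclideanSpace ℝ (Fin 3)) → ℝ} (hu : Continuous u) {a : ℝ} (ha : 0 < a)
    (hua : ∀ z : (EuclideanSpace ℝ (Fin 3)), ‖z‖ < a → u z = 0) (hG : ContinuousOn G {0}ᶜ) : Continuous fun z ↦ u z * G z := by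
  rw [continuous_iff_continuousAt]
  intro z
  by_cases hz : ‖z‖ < a
  · have hev : (fun w ↦ u w * G w) =ᶠ[𝓝 z] fun _ ↦ 0 := by
      filter_upwards [isOpen_lt continuous_norm continuous_const |>.mem_nhds hz] with w hw
      rw [hua w hw, zero_mul]
    exact (continuousAt_const.congr hev.symm)
  · have hz0 : z ≠ 0 := by
      intro h; rw [h, norm_zero] at hz; exact hz ha
    exact hu.continuousAt.mul (hG.continuousAt (isOpen_compl_singleton.mem_nhds hz0))

variable {C : ℝ}

/-- **The shell cutoff** `ψ = (1 − θ_{a,a+δ}) θ_{b−δ,b}`: smooth. [folklore] -/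
theorem contDiff_shellCutoff (a b δ : ℝ) {n : ℕ∞} :
    ContDiff ℝ n fun z : (EuclideanSpace ℝ (Fin 3)) ↦ (1 - radialCutoff a (a + δ) z) * radialCutoff (b - δ) b z :=
  (contDiff_const.sub (radialCutoff_contDiff a (a + δ))).mul (radialCutoff_contDiff (b - δ) b)

/-- `0 ≤ ψ ≤ 1`, as `|ψ| ≤ 1`. [folklore] -/
theorem abs_shellCutoff_le_one (a b δ : ℝ) (z : (EuclideanSpace ℝ (Fin 3))) :
    |(1 - radialCutoff a (a + δ) z) * radialCutoff (b - δ) b z| ≤ 1 := by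
  rw [abs_mul]
  have h1 : |1 - radialCutoff a (a + δ) z| ≤ 1 := by
    rw [abs_le]; constructor <;> linarith [radialCutoff_nonneg a (a + δ) z, radialCutoff_le_one a (a + δ) z]
  have h2 : |radialCutoff (b - δ) b z| ≤ 1 := abs_radialCutoff_le_one _ _ _
  exact mul_le_one₀ h1 (abs_nonneg _) h2

/-- `ψ = 0` on `|z| ≤ a`. [folklore] -/
theorem shellCutoff_eq_zero_of_le {a b δ : ℝ} (ha : 0 ≤ a) (hδ : 0 < δ) {z : (EuclideanSpace ℝ (Fin 3))} (hz : ‖z‖ ≤ a) :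
    (1 - radialCutoff a (a + δ) z) * radialCutoff (b - δ) b z = 0 := by
  rw [radialCutoff_eq_one ha (by linarith) hz, sub_self, zero_mul]

/-- `ψ = 0` on `|z| ≥ b`. [folklore] -/
theorem shellCutoff_eq_zero_of_ge {a b δ : ℝ} (hδ : 0 < δ) (hb : δ ≤ b) {z : (EuclideanSpace ℝ (Fin 3))} (hz : b ≤ ‖z‖) :
    (1 - radialCutoff a (a + δ) z) * radialCutoff (b - δ) b z = 0 := by
  rw [radialCutoff_eq_zero (r₀ := b - δ) (by linarith) (by linarith) hz, mul_zero]

/-- `ψ = 1` on `a + δ ≤ |z| ≤ b − δ`. [folklore] -/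
theorem shellCutoff_eq_one {a b δ : ℝ} (ha : 0 ≤ a) (hδ : 0 < δ) {z : (EuclideanSpace ℝ (Fin 3))} (h1 : a + δ ≤ ‖z‖)
    (h2 : ‖z‖ ≤ b - δ) : (1 - radialCutoff a (a + δ) z) * radialCutoff (b - δ) b z = 1 := by
  have hbδ : 0 ≤ b - δ := by linarith [norm_nonneg z]
  rw [radialCutoff_eq_zero ha (by linarith) h1, radialCutoff_eq_one (r₀ := b - δ) hbδ (by linarith) h2]
  ring

/-- **Gradient of the shell cutoff**: supported in the two transition shells, with `‖∇ψ‖ ≤ 2C/δ` there. [folklore] -/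
theorem norm_fderiv_shellCutoff_le (hC0 : 0 ≤ C) (hC : ∀ x : ℝ, ‖deriv Real.smoothTransition x‖ ≤ C) {a b δ : ℝ}
    (ha : 0 ≤ a) (hδ : 0 < δ) (hb : δ ≤ b) (z : (EuclideanSpace ℝ (Fin 3))) :
    ‖fderiv ℝ (fun z : (EuclideanSpace ℝ (Fin 3)) ↦ (1 - radialCutoff a (a + δ) z) * radialCutoff (b - δ) b z) z‖ ≤
      (closedBall (0 : (EuclideanSpace ℝ (Fin 3))) (a + δ) \ ball 0 a).indicator (fun _ ↦ 2 * C / δ) z +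
        (closedBall (0 : (EuclideanSpace ℝ (Fin 3))) b \ ball 0 (b - δ)).indicator (fun _ ↦ 2 * C / δ) z := by
  have hθ1 : Differentiable ℝ (radialCutoff a (a + δ) : (EuclideanSpace ℝ (Fin 3)) → ℝ) :=
    (radialCutoff_contDiff (E' := (EuclideanSpace ℝ (Fin 3))) a (a + δ) (n := 1)).differentiable one_ne_zero
  have hθ2 : Differentiable ℝ (radialCutoff (b - δ) b : (EuclideanSpace ℝ (Fin 3)) → ℝ) :=
    (radialCutoff_contDiff (E' := (EuclideanSpace ℝ (Fin 3))) (b - δ) b (n := 1)).differentiable one_ne_zero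
  have hd1 : DifferentiableAt ℝ (fun z : (EuclideanSpace ℝ (Fin 3)) ↦ 1 - radialCutoff a (a + δ) z) z := (hθ1 z).const_sub 1
  rw [fderiv_fun_mul hd1 (hθ2 z), fderiv_const_sub]
  -- bounds for the two gradients, with support information
  have g1 : ‖fderiv ℝ (radialCutoff a (a + δ) : (EuclideanSpace ℝ (Fin 3)) → ℝ) z‖ ≤
      (closedBall (0 : (EuclideanSpace ℝ (Fin 3))) (a + δ) \ ball 0 a).indicator (fun _ ↦ 2 * C / δ) z := by
    by_cases hz : z ∈ closedBall (0 : (EuclideanSpace ℝ (Fin 3))) (a + δ) \ ball 0 a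
    · rw [indicator_of_mem hz]
      have := norm_fderiv_radialCutoff_le hC0 hC ha (by linarith : a < a + δ) z
      rwa [show a + δ - a = δ by ring] at this
    · rw [indicator_of_notMem hz]
      rw [Set.mem_sdiff, not_and_or, not_not, mem_closedBall, dist_zero_right, not_le, mem_ball, dist_zero_right] at hz
      rcases hz with hz | hz
      · rw [fderiv_radialCutoff_eq_zero_of_gt ha (by linarith) hz, norm_zero]
      · rw [fderiv_radialCutoff_eq_zero_of_lt ha (by linarith) hz, norm_zero]
  have g2 : ‖fderiv ℝ (radialCutoff (b - δ) b : (EuclideanSpace ℝ (Fin 3)) → ℝ) z‖ ≤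
      (closedBall (0 : (EuclideanSpace ℝ (Fin 3))) b \ ball 0 (b - δ)).indicator (fun _ ↦ 2 * C / δ) z := by
    by_cases hz : z ∈ closedBall (0 : (EuclideanSpace ℝ (Fin 3))) b \ ball 0 (b - δ)
    · rw [indicator_of_mem hz]
      have := norm_fderiv_radialCutoff_le hC0 hC (by linarith : 0 ≤ b - δ) (by linarith : b - δ < b) z
      rwa [show b - (b - δ) = δ by ring] at this
    · rw [indicator_of_notMem hz]
      rw [Set.mem_sdiff, not_and_or, not_not, mem_closedBall, dist_zero_right, not_le, mem_ball, dist_zero_right] at hz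
      rcases hz with hz | hz
      · rw [fderiv_radialCutoff_eq_zero_of_gt (by linarith) (by linarith) hz, norm_zero]
      · rw [fderiv_radialCutoff_eq_zero_of_lt (by linarith) (by linarith) hz, norm_zero]
  have hθ2v : |radialCutoff (b - δ) b z| ≤ 1 := abs_radialCutoff_le_one _ _ _
  have h1v : |1 - radialCutoff a (a + δ) z| ≤ 1 := by
    rw [abs_le]; constructor <;> linarith [radialCutoff_nonneg a (a + δ) z, radialCutoff_le_one a (a + δ) z]
  calc ‖(1 - radialCutoff a (a + δ) z) • fderiv ℝ (radialCutoff (b - δ) b) z +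
        radialCutoff (b - δ) b z • -fderiv ℝ (radialCutoff a (a + δ)) z‖
      ≤ ‖(1 - radialCutoff a (a + δ) z) • fderiv ℝ (radialCutoff (b - δ) b) z‖ +
        ‖radialCutoff (b - δ) b z • -fderiv ℝ (radialCutoff a (a + δ)) z‖ := norm_add_le _ _
    _ ≤ 1 * ‖fderiv ℝ (radialCutoff (b - δ) b : (EuclideanSpace ℝ (Fin 3)) → ℝ) z‖ + 1 * ‖fderiv ℝ (radialCutoff a (a + δ) : (EuclideanSpace ℝ (Fin 3)) → ℝ) z‖ := by
        rw [norm_smul, norm_smul, norm_neg, Real.norm_eq_abs, Real.norm_eq_abs]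
        gcongr
    _ ≤ _ := by rw [one_mul, one_mul, add_comm]; exact add_le_add g1 g2

end ShellCutoff

section Cancellation

variable {K G : (EuclideanSpace ℝ (Fin 3)) → ℝ} {A B C ε : ℝ} {v : (EuclideanSpace ℝ (Fin 3))}

/-- The gradient of `θ_ε` is supported in the shell `ε ≤ |z| ≤ 2ε`, where it is `≤ B/ε`. [folklore] -/
theorem norm_fderiv_radialCutoff_eps_le_indicator
    (hB : ∀ ε : ℝ, 0 < ε → ∀ z : (EuclideanSpace ℝ (Fin 3)), ‖fderiv ℝ (radialCutoff ε (2 * ε)) z‖ ≤ B * ε⁻¹) (hε : 0 < ε) (z : (EuclideanSpace ℝ (Fin 3))) :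
    ‖fderiv ℝ (radialCutoff ε (2 * ε) : (EuclideanSpace ℝ (Fin 3)) → ℝ) z‖ ≤ (closedBall (0 : (EuclideanSpace ℝ (Fin 3))) (2 * ε) \ ball 0 ε).indicator (fun _ ↦ B * ε⁻¹) z := by
  by_cases hz : z ∈ closedBall (0 : (EuclideanSpace ℝ (Fin 3))) (2 * ε) \ ball 0 ε
  · rw [indicator_of_mem hz]; exact hB ε hε z
  · rw [indicator_of_notMem hz]
    rw [Set.mem_sdiff, not_and_or, not_not, mem_closedBall, dist_zero_right, not_le, mem_ball, dist_zero_right] at hz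
    rcases hz with hz | hz
    · rw [fderiv_radialCutoff_eq_zero_of_gt hε.le (by linarith) hz, norm_zero]
    · rw [fderiv_radialCutoff_eq_zero_of_lt hε.le (by linarith) hz, norm_zero]

/-- `|G|` is integrable on shells away from the origin when `G` is continuous off the origin. [folklore] -/
theorem integrableOn_shell_of_continuousOn {G : (EuclideanSpace ℝ (Fin 3)) → ℝ} (hG : ContinuousOn G {0}ᶜ) {r₀ r₁ : ℝ} (h₀ : 0 < r₀) :
    IntegrableOn G (closedBall (0 : (EuclideanSpace ℝ (Fin 3))) r₁ \ ball 0 r₀) := by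
  have hc : IsCompact (closedBall (0 : (EuclideanSpace ℝ (Fin 3))) r₁ \ ball 0 r₀) :=
    (isCompact_closedBall 0 r₁).of_isClosed_subset (isClosed_closedBall.sdiff isOpen_ball) fun _ hz ↦ hz.1
  refine ContinuousOn.integrableOn_compact hc (hG.mono fun z hz ↦ ?_)
  have : r₀ ≤ ‖z‖ := by simpa using hz.2
  exact norm_pos_iff.1 (h₀.trans_le this)

/-- Bound for the integral of `c |G|` over a shell (indicator form). [folklore] -/
theorem integral_indicator_shell_le (hA2 : ∀ z : (EuclideanSpace ℝ (Fin 3)), z ≠ 0 → |G z| ≤ A * (‖z‖ ^ 2)⁻¹)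
    {r₀ r₁ c : ℝ} (h₀ : 0 < r₀) (h₁ : r₀ ≤ r₁) (hc : 0 ≤ c) :
    ∫ z, (closedBall (0 : (EuclideanSpace ℝ (Fin 3))) r₁ \ ball 0 r₀).indicator (fun z ↦ c * |G z|) z ≤
      c * A * (r₀ ^ 2)⁻¹ * ((r₁ ^ 3 - r₀ ^ 3) * (volume : Measure (EuclideanSpace ℝ (Fin 3))).real (ball 0 1)) := by
  have hA : 0 ≤ A := by
    obtain ⟨z, hz⟩ := exists_ne (0 : (EuclideanSpace ℝ (Fin 3)))
    have h := hA2 z hz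
    by_contra hA'
    have : A * (‖z‖ ^ 2)⁻¹ < 0 := mul_neg_of_neg_of_pos (not_le.1 hA') (by positivity [norm_pos_iff.2 hz])
    linarith [abs_nonneg (G z)]
  rw [integral_indicator (measurableSet_closedBall.diff measurableSet_ball)]
  have h := setIntegral_shell_inv_sq_le h₀ h₁ (mul_nonneg hc hA) (f := fun z ↦ c * |G z|) fun z hz ↦ by
    rw [Real.norm_eq_abs, abs_mul, abs_abs, abs_of_nonneg hc, mul_assoc]
    gcongr
    exact hA2 z (norm_pos_iff.1 (h₀.trans_le hz))
  rw [Real.norm_of_nonneg (integral_nonneg fun z ↦ by positivity)] at h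
  calc _ ≤ c * A * (r₀ ^ 2)⁻¹ * ((r₁ ^ 3 - r₀ ^ 3) * (volume : Measure (EuclideanSpace ℝ (Fin 3))).real (ball 0 1)) := h

/-- **Cancellation over smooth shells**: if `K = ∂_v G` off the origin with `|G| ≤ A|z|⁻²`, then for the shell cutoff
`ψ = (1 − θ_{a,a+δ})θ_{b−δ,b}` (`0 < δ ≤ a`, `2δ ≤ b`) and every `ε > 0`,
`|∫ ψ K_ε| ≤ |v| A |B₁| (38 C + 7 B)` — integration by parts moves the derivative onto the cutoffs, whose gradients
live on shells of thickness `δ` (resp. `ε`) where `|G| ≲ A r⁻²`. [folklore] -/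
theorem norm_integral_shellCutoff_truncate_le (hK : ContinuousOn K {0}ᶜ) (hG : ∀ z : (EuclideanSpace ℝ (Fin 3)), z ≠ 0 → DifferentiableAt ℝ G z)
    (hKG : ∀ z : (EuclideanSpace ℝ (Fin 3)), z ≠ 0 → K z = fderiv ℝ G z v) (hA2 : ∀ z : (EuclideanSpace ℝ (Fin 3)), z ≠ 0 → |G z| ≤ A * (‖z‖ ^ 2)⁻¹)
    (hB0 : 0 ≤ B) (hB : ∀ ε : ℝ, 0 < ε → ∀ z : (EuclideanSpace ℝ (Fin 3)), ‖fderiv ℝ (radialCutoff ε (2 * ε)) z‖ ≤ B * ε⁻¹)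
    (hC0 : 0 ≤ C) (hC : ∀ x : ℝ, ‖deriv Real.smoothTransition x‖ ≤ C) (hε : 0 < ε) {a b δ : ℝ} (ha : 0 < a)
    (hδ : 0 < δ) (hδa : δ ≤ a) (hδb : 2 * δ ≤ b) :
    ‖∫ z : (EuclideanSpace ℝ (Fin 3)), ((1 - radialCutoff a (a + δ) z) * radialCutoff (b - δ) b z) *
        ((1 - radialCutoff ε (2 * ε) z) * K z)‖ ≤
      ‖v‖ * (A * (volume : Measure (EuclideanSpace ℝ (Fin 3))).real (ball 0 1) * (38 * C + 7 * B)) := by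
  have hA : 0 ≤ A := by
    obtain ⟨z, hz⟩ := exists_ne (0 : (EuclideanSpace ℝ (Fin 3)))
    have h := hA2 z hz
    by_contra hA'
    have : A * (‖z‖ ^ 2)⁻¹ < 0 := mul_neg_of_neg_of_pos (not_le.1 hA') (by positivity [norm_pos_iff.2 hz])
    linarith [abs_nonneg (G z)]
  have hGc : ContinuousOn G {0}ᶜ := fun z hz ↦ (hG z hz).continuousAt.continuousWithinAt
  set V : ℝ := (volume : Measure (EuclideanSpace ℝ (Fin 3))).real (ball 0 1) with hV
  have hV0 : 0 ≤ V := measureReal_nonneg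
  set ψ : (EuclideanSpace ℝ (Fin 3)) → ℝ := fun z ↦ (1 - radialCutoff a (a + δ) z) * radialCutoff (b - δ) b z with hψ
  set θ : (EuclideanSpace ℝ (Fin 3)) → ℝ := radialCutoff ε (2 * ε) with hθ
  set u : (EuclideanSpace ℝ (Fin 3)) → ℝ := fun z ↦ ψ z * (1 - θ z) with hu
  have hψs : ContDiff ℝ 1 ψ := contDiff_shellCutoff a b δ
  have hθs : ContDiff ℝ 1 θ := radialCutoff_contDiff ε (2 * ε)
  have hus : ContDiff ℝ 1 u := hψs.mul (contDiff_const.sub hθs)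
  have huc : Continuous u := hus.continuous
  have hud : Differentiable ℝ u := hus.differentiable one_ne_zero
  have hu_a : ∀ z : (EuclideanSpace ℝ (Fin 3)), ‖z‖ ≤ a → u z = 0 := fun z hz ↦ by
    simp only [hu, hψ, shellCutoff_eq_zero_of_le ha.le hδ hz, zero_mul]
  have hu_b : ∀ z : (EuclideanSpace ℝ (Fin 3)), b ≤ ‖z‖ → u z = 0 := fun z hz ↦ by
    simp only [hu, hψ, shellCutoff_eq_zero_of_ge hδ (by linarith) hz, zero_mul]
  have hu_cpt : HasCompactSupport u :=
    HasCompactSupport.intro (isCompact_closedBall (0 : (EuclideanSpace ℝ (Fin 3))) b) fun z hz ↦ hu_b z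
      (by rw [mem_closedBall, dist_zero_right, not_le] at hz; exact hz.le)
  have hu_tsupp : ∀ z ∈ tsupport u, z ≠ 0 := by
    intro z hz h0
    have hsub : tsupport u ⊆ {z : (EuclideanSpace ℝ (Fin 3)) | a ≤ ‖z‖} :=
      closure_minimal (fun w hw ↦ by
        by_contra h; exact hw (hu_a w (not_le.1 h).le)) (isClosed_le continuous_const continuous_norm)
    have := hsub hz
    rw [h0, mem_setOf_eq, norm_zero] at this
    linarith
  -- `fderiv u` vanishes on the open ball `|z| < a`
  have hfu_a : ∀ z : (EuclideanSpace ℝ (Fin 3)), ‖z‖ < a → fderiv ℝ u z = 0 := by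
    intro z hz
    have hev : u =ᶠ[𝓝 z] fun _ ↦ 0 := by
      filter_upwards [isOpen_lt continuous_norm continuous_const |>.mem_nhds hz] with w hw
      exact hu_a w hw.le
    rw [hev.fderiv_eq, fderiv_const_apply]
  -- the integrand is `u · ∂_v G`
  have hint_eq : (fun z : (EuclideanSpace ℝ (Fin 3)) ↦ ((1 - radialCutoff a (a + δ) z) * radialCutoff (b - δ) b z) *
      ((1 - radialCutoff ε (2 * ε) z) * K z)) = fun z ↦ u z * fderiv ℝ G z v := by
    funext z
    by_cases hz : z = 0
    · subst hz
      have : u 0 = 0 := hu_a 0 (by simp [ha.le])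
      simp only [hu, hψ, hθ] at this ⊢
      rw [← mul_assoc, this, zero_mul, zero_mul]
    · simp only [hu, hψ, hθ, hKG z hz]; ring
  have huK : (fun z ↦ u z * fderiv ℝ G z v) = fun z ↦ u z * K z := by
    funext z
    by_cases hz : z = 0
    · subst hz; rw [hu_a 0 (by simp [ha.le]), zero_mul, zero_mul]
    · rw [hKG z hz]
  -- integrability for the integration by parts
  have hI1 : Integrable fun z ↦ fderiv ℝ u z v * G z := by
    refine Continuous.integrable_of_hasCompactSupport ?_ (hu_cpt.fderiv_apply (𝕜 := ℝ) v |>.mul_right)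
    exact continuous_mul_of_eqOn_ball_zero ((hus.continuous_fderiv one_ne_zero).clm_apply continuous_const) ha
      (fun z hz ↦ by rw [hfu_a z hz, _root_.zero_apply]) hGc
  have hI2 : Integrable fun z ↦ u z * fderiv ℝ G z v := by
    rw [huK]
    exact Continuous.integrable_of_hasCompactSupport
      (continuous_mul_of_eqOn_ball_zero huc ha (fun z hz ↦ hu_a z hz.le) hK) hu_cpt.mul_right
  have hI3 : Integrable fun z ↦ u z * G z :=
    Continuous.integrable_of_hasCompactSupport
      (continuous_mul_of_eqOn_ball_zero huc ha (fun z hz ↦ hu_a z hz.le) hGc) hu_cpt.mul_right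
  have hibp := integral_mul_fderiv_eq_neg_fderiv_mul_of_integrable hI1 hI2 hI3 (fun z _ ↦ hud z)
    fun z hz ↦ hG z (hu_tsupp z hz)
  rw [hint_eq, hibp, norm_neg]
  -- pointwise bound of the new integrand by three shell indicators
  set F₁ : (EuclideanSpace ℝ (Fin 3)) → ℝ := (closedBall (0 : (EuclideanSpace ℝ (Fin 3))) (a + δ) \ ball 0 a).indicator fun z ↦ ‖v‖ * (2 * C / δ) * |G z| with hF₁
  set F₂ : (EuclideanSpace ℝ (Fin 3)) → ℝ := (closedBall (0 : (EuclideanSpace ℝ (Fin 3))) b \ ball 0 (b - δ)).indicator fun z ↦ ‖v‖ * (2 * C / δ) * |G z| with hF₂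
  set F₃ : (EuclideanSpace ℝ (Fin 3)) → ℝ := (closedBall (0 : (EuclideanSpace ℝ (Fin 3))) (2 * ε) \ ball 0 ε).indicator fun z ↦ ‖v‖ * (B * ε⁻¹) * |G z| with hF₃
  have hpt : ∀ z, ‖fderiv ℝ u z v * G z‖ ≤ F₁ z + F₂ z + F₃ z := by
    intro z
    have hdψ : DifferentiableAt ℝ ψ z := hψs.differentiable one_ne_zero z
    have hdθ : DifferentiableAt ℝ (fun w ↦ 1 - θ w) z := (hθs.differentiable one_ne_zero z).const_sub 1
    have hprod : fderiv ℝ u z v = fderiv ℝ ψ z v * (1 - θ z) + ψ z * -(fderiv ℝ θ z v) := by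
      simp only [hu]
      rw [fderiv_fun_mul hdψ hdθ, fderiv_const_sub]
      simp only [_root_.add_apply, _root_.smul_apply, smul_eq_mul, _root_.neg_apply]
      ring
    have b1 : |fderiv ℝ ψ z v| ≤ ((closedBall (0 : (EuclideanSpace ℝ (Fin 3))) (a + δ) \ ball 0 a).indicator (fun _ ↦ 2 * C / δ) z +
        (closedBall (0 : (EuclideanSpace ℝ (Fin 3))) b \ ball 0 (b - δ)).indicator (fun _ ↦ 2 * C / δ) z) * ‖v‖ := by
      rw [← Real.norm_eq_abs]
      exact (ContinuousLinearMap.le_opNorm _ v).trans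
        (mul_le_mul_of_nonneg_right (norm_fderiv_shellCutoff_le hC0 hC ha.le hδ (by linarith) z) (norm_nonneg _))
    have b2 : |fderiv ℝ θ z v| ≤ (closedBall (0 : (EuclideanSpace ℝ (Fin 3))) (2 * ε) \ ball 0 ε).indicator (fun _ ↦ B * ε⁻¹) z * ‖v‖ := by
      rw [← Real.norm_eq_abs]
      exact (ContinuousLinearMap.le_opNorm _ v).trans
        (mul_le_mul_of_nonneg_right (norm_fderiv_radialCutoff_eps_le_indicator hB hε z) (norm_nonneg _))
    have b3 : |1 - θ z| ≤ 1 := abs_one_sub_radialCutoff_le ε z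
    have b4 : |ψ z| ≤ 1 := abs_shellCutoff_le_one a b δ z
    have hi1 : 0 ≤ (closedBall (0 : (EuclideanSpace ℝ (Fin 3))) (a + δ) \ ball 0 a).indicator (fun _ ↦ 2 * C / δ) z :=
      indicator_nonneg (fun _ _ ↦ by positivity) z
    have hi2 : 0 ≤ (closedBall (0 : (EuclideanSpace ℝ (Fin 3))) b \ ball 0 (b - δ)).indicator (fun _ ↦ 2 * C / δ) z :=
      indicator_nonneg (fun _ _ ↦ by positivity) z
    have hi3 : 0 ≤ (closedBall (0 : (EuclideanSpace ℝ (Fin 3))) (2 * ε) \ ball 0 ε).indicator (fun _ ↦ B * ε⁻¹) z :=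
      indicator_nonneg (fun _ _ ↦ by positivity) z
    -- rewrite the three indicators of products as products with indicators of constants
    have e1 : F₁ z = (closedBall (0 : (EuclideanSpace ℝ (Fin 3))) (a + δ) \ ball 0 a).indicator (fun _ ↦ 2 * C / δ) z * ‖v‖ * |G z| := by
      simp only [hF₁, indicator]; split_ifs <;> ring
    have e2 : F₂ z = (closedBall (0 : (EuclideanSpace ℝ (Fin 3))) b \ ball 0 (b - δ)).indicator (fun _ ↦ 2 * C / δ) z * ‖v‖ * |G z| := by
      simp only [hF₂, indicator]; split_ifs <;> ring
    have e3 : F₃ z = (closedBall (0 : (EuclideanSpace ℝ (Fin 3))) (2 * ε) \ ball 0 ε).indicator (fun _ ↦ B * ε⁻¹) z * ‖v‖ * |G z| := by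
      simp only [hF₃, indicator]; split_ifs <;> ring
    rw [e1, e2, e3, Real.norm_eq_abs, abs_mul, hprod]
    calc |fderiv ℝ ψ z v * (1 - θ z) + ψ z * -fderiv ℝ θ z v| * |G z|
        ≤ (|fderiv ℝ ψ z v| * |1 - θ z| + |ψ z| * |fderiv ℝ θ z v|) * |G z| := by
          gcongr
          calc _ ≤ |fderiv ℝ ψ z v * (1 - θ z)| + |ψ z * -fderiv ℝ θ z v| := abs_add_le _ _
            _ = _ := by rw [abs_mul, abs_mul, abs_neg]
      _ ≤ ((((closedBall (0 : (EuclideanSpace ℝ (Fin 3))) (a + δ) \ ball 0 a).indicator (fun _ ↦ 2 * C / δ) z +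
            (closedBall (0 : (EuclideanSpace ℝ (Fin 3))) b \ ball 0 (b - δ)).indicator (fun _ ↦ 2 * C / δ) z) * ‖v‖) * 1 +
            1 * ((closedBall (0 : (EuclideanSpace ℝ (Fin 3))) (2 * ε) \ ball 0 ε).indicator (fun _ ↦ B * ε⁻¹) z * ‖v‖)) * |G z| := by
          gcongr
      _ = _ := by ring
  -- integrate
  have hF₁i : Integrable F₁ := by
    rw [hF₁, integrable_indicator_iff (measurableSet_closedBall.diff measurableSet_ball)]
    exact ((integrableOn_shell_of_continuousOn hGc ha).norm.const_mul (‖v‖ * (2 * C / δ))).congr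
      (Eventually.of_forall fun z ↦ by simp only [Real.norm_eq_abs])
  have hF₂i : Integrable F₂ := by
    rw [hF₂, integrable_indicator_iff (measurableSet_closedBall.diff measurableSet_ball)]
    exact ((integrableOn_shell_of_continuousOn hGc (by linarith : 0 < b - δ)).norm.const_mul (‖v‖ * (2 * C / δ))).congr
      (Eventually.of_forall fun z ↦ by simp only [Real.norm_eq_abs])
  have hF₃i : Integrable F₃ := by
    rw [hF₃, integrable_indicator_iff (measurableSet_closedBall.diff measurableSet_ball)]
    exact ((integrableOn_shell_of_continuousOn hGc hε).norm.const_mul (‖v‖ * (B * ε⁻¹))).congr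
      (Eventually.of_forall fun z ↦ by simp only [Real.norm_eq_abs])
  have hstep : ‖∫ z, fderiv ℝ u z v * G z‖ ≤ ∫ z, (F₁ z + F₂ z + F₃ z) :=
    norm_integral_le_of_norm_le ((hF₁i.add hF₂i).add hF₃i) (Eventually.of_forall hpt)
  have h12 : Integrable fun z ↦ F₁ z + F₂ z := hF₁i.add hF₂i
  have hsplit : ∫ z, (F₁ z + F₂ z + F₃ z) = (∫ z, F₁ z) + (∫ z, F₂ z) + ∫ z, F₃ z := by
    rw [integral_add h12 hF₃i, integral_add hF₁i hF₂i]
  -- the three shell integrals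
  have J1 : ∫ z, F₁ z ≤ ‖v‖ * (2 * C / δ) * A * (a ^ 2)⁻¹ * (((a + δ) ^ 3 - a ^ 3) * V) :=
    integral_indicator_shell_le hA2 ha (by linarith) (by positivity)
  have J2 : ∫ z, F₂ z ≤ ‖v‖ * (2 * C / δ) * A * ((b - δ) ^ 2)⁻¹ * ((b ^ 3 - (b - δ) ^ 3) * V) :=
    integral_indicator_shell_le hA2 (by linarith) (by linarith) (by positivity)
  have J3 : ∫ z, F₃ z ≤ ‖v‖ * (B * ε⁻¹) * A * (ε ^ 2)⁻¹ * (((2 * ε) ^ 3 - ε ^ 3) * V) :=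
    integral_indicator_shell_le hA2 hε (by linarith) (by positivity)
  -- elementary estimates of the three constants
  have K1 : ‖v‖ * (2 * C / δ) * A * (a ^ 2)⁻¹ * (((a + δ) ^ 3 - a ^ 3) * V) ≤ ‖v‖ * (14 * C * A * V) := by
    have h1 : (2 * C / δ) * (a ^ 2)⁻¹ * ((a + δ) ^ 3 - a ^ 3) ≤ 14 * C := by
      rw [show (a + δ) ^ 3 - a ^ 3 = δ * (3 * a ^ 2 + 3 * a * δ + δ ^ 2) by ring]
      rw [show (2 * C / δ) * (a ^ 2)⁻¹ * (δ * (3 * a ^ 2 + 3 * a * δ + δ ^ 2)) =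
        2 * C * ((3 * a ^ 2 + 3 * a * δ + δ ^ 2) / a ^ 2) by field_simp]
      have : (3 * a ^ 2 + 3 * a * δ + δ ^ 2) / a ^ 2 ≤ 7 := by
        rw [div_le_iff₀ (by positivity)]; nlinarith
      nlinarith
    calc _ = ‖v‖ * (A * V) * ((2 * C / δ) * (a ^ 2)⁻¹ * ((a + δ) ^ 3 - a ^ 3)) := by ring
      _ ≤ ‖v‖ * (A * V) * (14 * C) := by gcongr
      _ = _ := by ring
  have K2 : ‖v‖ * (2 * C / δ) * A * ((b - δ) ^ 2)⁻¹ * ((b ^ 3 - (b - δ) ^ 3) * V) ≤ ‖v‖ * (24 * C * A * V) := by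
    have hbδ : 0 < b - δ := by linarith
    have h1 : (2 * C / δ) * ((b - δ) ^ 2)⁻¹ * (b ^ 3 - (b - δ) ^ 3) ≤ 24 * C := by
      rw [show b ^ 3 - (b - δ) ^ 3 = δ * (3 * b ^ 2 - 3 * b * δ + δ ^ 2) by ring]
      rw [show (2 * C / δ) * ((b - δ) ^ 2)⁻¹ * (δ * (3 * b ^ 2 - 3 * b * δ + δ ^ 2)) =
        2 * C * ((3 * b ^ 2 - 3 * b * δ + δ ^ 2) / (b - δ) ^ 2) by field_simp]
      have : (3 * b ^ 2 - 3 * b * δ + δ ^ 2) / (b - δ) ^ 2 ≤ 12 := by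
        rw [div_le_iff₀ (by positivity)]; nlinarith
      nlinarith
    calc _ = ‖v‖ * (A * V) * ((2 * C / δ) * ((b - δ) ^ 2)⁻¹ * (b ^ 3 - (b - δ) ^ 3)) := by ring
      _ ≤ ‖v‖ * (A * V) * (24 * C) := by gcongr
      _ = _ := by ring
  have K3 : ‖v‖ * (B * ε⁻¹) * A * (ε ^ 2)⁻¹ * (((2 * ε) ^ 3 - ε ^ 3) * V) = ‖v‖ * (7 * B * A * V) := by
    field_simp; ring
  calc ‖∫ z, fderiv ℝ u z v * G z‖ ≤ (∫ z, F₁ z) + (∫ z, F₂ z) + ∫ z, F₃ z := hstep.trans hsplit.le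
    _ ≤ ‖v‖ * (14 * C * A * V) + ‖v‖ * (24 * C * A * V) + ‖v‖ * (7 * B * A * V) :=
        add_le_add (add_le_add (J1.trans K1) (J2.trans K2)) (J3.trans K3.le)
    _ = ‖v‖ * (A * V * (38 * C + 7 * B)) := by ring

end Cancellation

section CancellationSharp

variable {K G : (EuclideanSpace ℝ (Fin 3)) → ℝ} {A B C ε : ℝ} {v : (EuclideanSpace ℝ (Fin 3))}

/-- **Cancellation condition (5.4.3) for the truncated kernel**: if `K = ∂_v G` off the origin with `|G| ≤ A|z|⁻²`
(`G` differentiable off the origin), then for all `0 < a < b` and `ε > 0`,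
`|∫_{a < |z| < b} K_ε| ≤ |v| A |B₁| (38 C + 7 B)` — the smooth-shell bound `norm_integral_shellCutoff_truncate_le`
passes to sharp shells by dominated convergence. [folklore] -/
theorem norm_setIntegral_shell_truncate_le (hK : ContinuousOn K {0}ᶜ) (hG : ∀ z : (EuclideanSpace ℝ (Fin 3)), z ≠ 0 → DifferentiableAt ℝ G z)
    (hKG : ∀ z : (EuclideanSpace ℝ (Fin 3)), z ≠ 0 → K z = fderiv ℝ G z v) (hA2 : ∀ z : (EuclideanSpace ℝ (Fin 3)), z ≠ 0 → |G z| ≤ A * (‖z‖ ^ 2)⁻¹)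
    (hB0 : 0 ≤ B) (hB : ∀ ε : ℝ, 0 < ε → ∀ z : (EuclideanSpace ℝ (Fin 3)), ‖fderiv ℝ (radialCutoff ε (2 * ε)) z‖ ≤ B * ε⁻¹)
    (hC0 : 0 ≤ C) (hC : ∀ x : ℝ, ‖deriv Real.smoothTransition x‖ ≤ C) (hε : 0 < ε) {a b : ℝ} (ha : 0 < a)
    (hab : a < b) :
    ‖∫ z in ball (0 : (EuclideanSpace ℝ (Fin 3))) b \ closedBall 0 a, (1 - radialCutoff ε (2 * ε) z) * K z‖ ≤
      ‖v‖ * (A * (volume : Measure (EuclideanSpace ℝ (Fin 3))).real (ball 0 1) * (38 * C + 7 * B)) := by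
  have hb : 0 < b := ha.trans hab
  set κ : (EuclideanSpace ℝ (Fin 3)) → ℝ := fun z ↦ (1 - radialCutoff ε (2 * ε) z) * K z with hκ
  have hκc : Continuous κ :=
    continuous_mul_of_eqOn_ball_zero (continuous_const.sub (radialCutoff_contDiff (n := 0) ε (2 * ε)).continuous) hε
      (fun z hz ↦ by rw [radialCutoff_eq_one hε.le (by linarith) hz.le, sub_self]) hK
  set U : Set (EuclideanSpace ℝ (Fin 3)) := ball (0 : (EuclideanSpace ℝ (Fin 3))) b \ closedBall 0 a with hU
  have hUm : MeasurableSet U := measurableSet_ball.diff measurableSet_closedBall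
  -- the approximating smooth shells
  set d : ℝ := min a (b / 2) with hd
  have hd0 : 0 < d := lt_min ha (by linarith)
  set δ : ℕ → ℝ := fun n ↦ d * (1 / ((n : ℝ) + 1)) with hδ
  have hδ0 : ∀ n, 0 < δ n := fun n ↦ by positivity
  have hδd : ∀ n, δ n ≤ d := fun n ↦ by
    have h1 : 1 / ((n : ℝ) + 1) ≤ 1 := by
      rw [div_le_one (by positivity)]; linarith [n.cast_nonneg (α := ℝ)]
    calc δ n = d * (1 / ((n : ℝ) + 1)) := rfl
      _ ≤ d * 1 := by gcongr
      _ = d := mul_one _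
  have hδa : ∀ n, δ n ≤ a := fun n ↦ (hδd n).trans (min_le_left _ _)
  have hδb : ∀ n, 2 * δ n ≤ b := fun n ↦ by linarith [hδd n, min_le_right a (b / 2)]
  have hδt : Tendsto δ atTop (𝓝 0) := by
    have := tendsto_one_div_add_atTop_nhds_zero_nat.const_mul d
    rwa [mul_zero] at this
  set F : ℕ → (EuclideanSpace ℝ (Fin 3)) → ℝ := fun n z ↦ ((1 - radialCutoff a (a + δ n) z) * radialCutoff (b - δ n) b z) * κ z with hF
  -- dominated convergence
  have hFm : ∀ n, AEStronglyMeasurable (F n) volume := fun n ↦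
    (((contDiff_shellCutoff a b (δ n) (n := 0)).continuous).mul hκc).aestronglyMeasurable
  have hbound_int : Integrable ((closedBall (0 : (EuclideanSpace ℝ (Fin 3))) b).indicator fun z ↦ |κ z|) := by
    rw [integrable_indicator_iff measurableSet_closedBall]
    exact (hκc.continuousOn.integrableOn_compact (isCompact_closedBall 0 b)).abs
  have hFle : ∀ n, ∀ᵐ z ∂(volume : Measure (EuclideanSpace ℝ (Fin 3))), ‖F n z‖ ≤ (closedBall (0 : (EuclideanSpace ℝ (Fin 3))) b).indicator (fun z ↦ |κ z|) z := by
    intro n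
    refine Eventually.of_forall fun z ↦ ?_
    by_cases hz : z ∈ closedBall (0 : (EuclideanSpace ℝ (Fin 3))) b
    · rw [indicator_of_mem hz, Real.norm_eq_abs, hF, abs_mul]
      calc _ ≤ 1 * |κ z| := by gcongr; exact abs_shellCutoff_le_one a b (δ n) z
        _ = |κ z| := one_mul _
    · rw [indicator_of_notMem hz, Real.norm_eq_abs, hF]
      rw [mem_closedBall, dist_zero_right, not_le] at hz
      simp only
      rw [shellCutoff_eq_zero_of_ge (hδ0 n) (by linarith [hδb n, hδ0 n]) hz.le, zero_mul, abs_zero]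
  have hlim : ∀ᵐ z ∂(volume : Measure (EuclideanSpace ℝ (Fin 3))), Tendsto (fun n ↦ F n z) atTop (𝓝 (U.indicator κ z)) := by
    refine Eventually.of_forall fun z ↦ ?_
    by_cases hz : z ∈ U
    · rw [indicator_of_mem hz]
      have hz1 : ‖z‖ < b := by simpa using hz.1
      have hz2 : a < ‖z‖ := by simpa using hz.2
      have hgap : 0 < min (‖z‖ - a) (b - ‖z‖) := lt_min (by linarith) (by linarith)
      have hev : ∀ᶠ n in atTop, δ n < min (‖z‖ - a) (b - ‖z‖) :=
        (tendsto_order.1 hδt).2 _ hgap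
      refine (tendsto_const_nhds (x := κ z)).congr' ?_
      filter_upwards [hev] with n hn
      rw [hF]
      simp only
      rw [shellCutoff_eq_one ha.le (hδ0 n) (by linarith [min_le_left (‖z‖ - a) (b - ‖z‖)])
        (by linarith [min_le_right (‖z‖ - a) (b - ‖z‖)]), one_mul]
    · rw [indicator_of_notMem hz]
      have hz' : ‖z‖ ≤ a ∨ b ≤ ‖z‖ := by
        rw [hU, Set.mem_sdiff, not_and_or, not_not, mem_ball, dist_zero_right, not_lt, mem_closedBall,
          dist_zero_right] at hz
        rcases hz with hz | hz
        · exact Or.inr hz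
        · exact Or.inl hz
      refine (tendsto_const_nhds (x := (0 : ℝ))).congr fun n ↦ ?_
      rw [hF]
      simp only
      rcases hz' with hz' | hz'
      · rw [shellCutoff_eq_zero_of_le ha.le (hδ0 n) hz', zero_mul]
      · rw [shellCutoff_eq_zero_of_ge (hδ0 n) (by linarith [hδb n, hδ0 n]) hz', zero_mul]
  have hT := tendsto_integral_of_dominated_convergence _ hFm hbound_int hFle hlim
  -- conclusion
  rw [← integral_indicator hUm]
  refine le_of_tendsto' (hT.norm) fun n ↦ ?_
  exact norm_integral_shellCutoff_truncate_le hK hG hKG hA2 hB0 hB hC0 hC hε ha (hδ0 n) (hδa n) (hδb n)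

end CancellationSharp


section L2

open scoped _root_.Convolution

variable {K G : (EuclideanSpace ℝ (Fin 3)) → ℝ} {A A' B C ε : ℝ} {v : (EuclideanSpace ℝ (Fin 3))}

/-- **Uniform `L²` bound for smoothly truncated kernels of degree `−3` with a primitive**: for `K ∈ C¹(ℝ³∖0)` with
`|K| ≤ A|z|⁻³`, `‖∇K‖ ≤ A|z|⁻⁴`, `K = ∂_v G` off the origin with `|G| ≤ A'|z|⁻²`, every `ε > 0` and `0 < ε' < N`,
`‖(1_{ε'<|·|<N} K_ε) ⋆ f‖₂ ≤ 15 (8A|B₁| + 24A(1+2B)|B₁| + |v|A'|B₁|(38C+7B)) ‖f‖₂` (Grafakos, Thm. 5.4.1 through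
`eLpNorm_truncatedKernel_convolution_le`; `B`, `C` the universal cutoff constants). [folklore] -/
theorem eLpNorm_truncate_convolution_le (hK : ContDiffOn ℝ 1 K {0}ᶜ)
    (hA0 : ∀ z : (EuclideanSpace ℝ (Fin 3)), z ≠ 0 → |K z| ≤ A * (‖z‖ ^ 3)⁻¹) (hA1 : ∀ z : (EuclideanSpace ℝ (Fin 3)), z ≠ 0 → ‖fderiv ℝ K z‖ ≤ A * (‖z‖ ^ 4)⁻¹)
    (hG : ∀ z : (EuclideanSpace ℝ (Fin 3)), z ≠ 0 → DifferentiableAt ℝ G z) (hKG : ∀ z : (EuclideanSpace ℝ (Fin 3)), z ≠ 0 → K z = fderiv ℝ G z v)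
    (hA2 : ∀ z : (EuclideanSpace ℝ (Fin 3)), z ≠ 0 → |G z| ≤ A' * (‖z‖ ^ 2)⁻¹)
    (hB0 : 0 ≤ B) (hB : ∀ ε : ℝ, 0 < ε → ∀ z : (EuclideanSpace ℝ (Fin 3)), ‖fderiv ℝ (radialCutoff ε (2 * ε)) z‖ ≤ B * ε⁻¹)
    (hC0 : 0 ≤ C) (hC : ∀ x : ℝ, ‖deriv Real.smoothTransition x‖ ≤ C) (hε : 0 < ε) {ε' N : ℝ} (hε' : 0 < ε')
    (hε'N : ε' < N) {f : (EuclideanSpace ℝ (Fin 3)) → ℂ} (hf : Integrable f) (hf2 : MemLp f 2) :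
    eLpNorm ((ball (0 : (EuclideanSpace ℝ (Fin 3))) N \ closedBall 0 ε').indicator (fun z : (EuclideanSpace ℝ (Fin 3)) ↦ (1 - radialCutoff ε (2 * ε) z) * K z)
        ⋆[ContinuousLinearMap.lsmul ℝ ℝ, volume] f) 2 volume ≤
      ENNReal.ofReal (15 * (8 * A * (volume : Measure (EuclideanSpace ℝ (Fin 3))).real (ball 0 1) +
        24 * A * (1 + 2 * B) * (volume : Measure (EuclideanSpace ℝ (Fin 3))).real (ball 0 1) +
        ‖v‖ * (A' * (volume : Measure (EuclideanSpace ℝ (Fin 3))).real (ball 0 1) * (38 * C + 7 * B)))) * eLpNorm f 2 volume :=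
  eLpNorm_truncatedKernel_convolution_le (fun a b _ ↦ integrableOn_truncate hK hε a b)
    (fun _ hR ↦ setIntegral_shell_norm_truncate_le hA0 hε hR)
    (fun _ hy N ↦ setIntegral_norm_truncate_sub_le hK hA0 hA1 hB0 hB hε hy N)
    (fun _ _ ha hab ↦ norm_setIntegral_shell_truncate_le hK.continuousOn hG hKG hA2 hB0 hB hC0 hC hε ha hab)
    hε' hε'N hf hf2

end L2

end Literature.Analysis.SingularIntegrals
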